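import Literature.AlgebraicGeometry.Resolution.AlterationsStrong
import Literature.AlgebraicGeometry.Resolution.AlterationsDimension
import Literature.AlgebraicGeometry.Motives.GenericFibre
import HarnessLib

/-!
# De Jong's alteration theorem: Chow's lemma and projective closure (de Jong 1996, 4.6–4.7)

Topic: `Literature/AlgebraicGeometry/Resolution`. Second layer under `AlterationsInduction.lean`:
the first two of the preliminary reductions 4.6–4.10 of the printed proof of de Jong 1996,
Thm. 4.1, PROVED.

* 4.7 (`DeJong1996.ConclusionGenericallyEtale.of_isOpenImmersion`): "Let `j : X → X̄` be an open
  immersion of `X` into a projective variety `X̄` over the field `k`. Let `Z̄ = j(Z) ∪ X̄ ∖ X`.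
  Suppose that `φ̄₁ : X̄₁' → X̄`, `j̄₁` solves the problem for the pair `(X̄, Z̄)`. […] Put
  `X₁ = φ̄₁⁻¹(j(X))`, `φ₁ = φ̄₁|_{X₁}` and `j₁ : X₁ → X̄₁` the inclusion morphism. Note that
  `j₁(φ₁⁻¹(Z)) ∪ X̄₁ ∖ X₁ = φ̄₁⁻¹(Z̄)` and that `φ₁` is an alteration." We take
  `X₁ = X̄₁' ×_{X̄} X` and do not need the printed remark that `j̄₁` is an isomorphism: with
  `j₁ = (X₁ → X̄₁') ≫ j̄₁` the boundary `j₁(φ₁⁻¹(Z)) ∪ X̄₁ ∖ j₁(X₁)` is literally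
  `j̄₁(φ̄₁⁻¹(Z̄)) ∪ X̄₁ ∖ j̄₁(X̄₁')`.
* 4.6 with 4.7 (`DeJong1996.conclusionGenericallyEtale_of_projective`): over any field, Thm. 4.1
  with its generically-étale clause for `(X, Z)` follows from the same statement for all pairs
  `(X', Z')` with `X'` a projective variety of the same dimension — by Chow's lemma in the
  integral form (`ChowLemmaIntegral_holds`: a modification `π : X' → X` with an immersion
  `X' → ℙⁿ_k`), the projective closure `X̄'` of `X'` in `ℙⁿ_k` (the scheme-theoretic image;
  `X' → X̄'` is an open immersion by `Literature.AlgebraicGeometry.Motives.isPullback_toImage_of_flat_mono`),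
  4.4 and 4.7.

## Sources

* A. J. de Jong, *Smoothness, semi-stability and alterations*, Publ. Math. IHÉS 83 (1996): 4.4,
  4.6, 4.7 (pp. 66–67).
-/

noncomputable section

open CategoryTheory CategoryTheory.Limits AlgebraicGeometry TopologicalSpace Topology

namespace Literature.AlgebraicGeometry.Resolution

universe u

/-! ## Base change of alterations along open immersions -/

section BaseChange

variable {X₁' Xbar X : Scheme.{u}} (φ' : X₁' ⟶ Xbar) (j : X ⟶ Xbar) [IsOpenImmersion j]

omit [IsOpenImmersion j] in
/-- Finiteness over an open `V` of the target passes to any base change: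
`X₁' ×_{X̄} X → X` is finite over `j⁻¹(V)` if `X₁' → X̄` is finite over `V`. [folklore] -/
theorem isFinite_pullback_snd_morphismRestrict (V : Xbar.Opens) [IsFinite (φ' ∣_ V)] :
    IsFinite (pullback.snd φ' j ∣_ j ⁻¹ᵁ V) := by
  -- the restriction of the base change is a base change of the restriction
  have sq₁ := (isPullback_morphismRestrict (pullback.snd φ' j) (j ⁻¹ᵁ V)).flip
  have sq₂ : IsPullback (pullback.fst φ' j) (pullback.snd φ' j) φ' j :=
    IsPullback.of_hasPullback _ _
  have big := sq₁.paste_horiz sq₂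
  -- `(j⁻¹ V).ι ≫ j = (j ∣_ V) ≫ V.ι`
  rw [← morphismRestrict_ι] at big
  have sq₃ := (isPullback_morphismRestrict φ' V).flip
  exact MorphismProperty.of_isPullback (big.of_right' sq₃) inferInstance

/-- **An alteration stays an alteration after base change along an open immersion with
non-empty source** (used in de Jong 1996, 4.7: "`φ₁ = φ̄₁|_{X₁}` […] is an alteration"): for
`φ̄₁ : X̄₁' → X̄` an alteration of the integral `X̄` and `j : X → X̄` an open immersion with `X`
non-empty, `X̄₁' ×_{X̄} X → X` is an alteration. [cite: DeJong1996, 4.7, p. 67] -/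
theorem IsAlteration.pullback_snd_of_isOpenImmersion [IsIntegral Xbar] [Nonempty X]
    (h : IsAlteration φ') : IsAlteration (pullback.snd φ' j) := by
  haveI := h.isIntegral
  haveI := h.isProper
  haveI : Surjective φ' := h.surjective
  haveI : Nonempty ↑(pullback φ' j) := by
    obtain ⟨x⟩ := ‹Nonempty X›
    obtain ⟨y, -⟩ := (pullback.snd φ' j).surjective x
    exact ⟨y⟩
  haveI : IsIntegral (pullback φ' j) := isIntegral_of_isOpenImmersion (pullback.fst φ' j)
  refine ⟨inferInstance, MorphismProperty.pullback_snd _ _ h.isProper, inferInstance, ?_⟩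
  obtain ⟨V, hV, hfin⟩ := h.exists_isFinite
  haveI := hfin
  refine ⟨j ⁻¹ᵁ V, ?_, isFinite_pullback_snd_morphismRestrict φ' j V⟩
  -- `V` meets the non-empty open `j(X)` of the irreducible `X̄`
  have hjX : (j.opensRange : Set Xbar).Nonempty := by
    obtain ⟨x⟩ := ‹Nonempty X›
    exact ⟨j x, x, rfl⟩
  obtain ⟨_, ⟨x, rfl⟩, hxV⟩ := (j.opensRange.isOpen.dense hjX).exists_mem_open V.isOpen hV
  exact ⟨x, hxV⟩

/-- **Generic étaleness passes to the base change along an open immersion** (de Jong 1996, 4.4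
with 4.7: the restricted alteration `φ₁ = φ̄₁|_{X₁}` is again generically étale): it is étale on
the preimage of the dense open of étaleness, which is dense. [folklore] -/
theorem IsGenericallyEtale.pullback_snd_of_isOpenImmersion (h : IsGenericallyEtale φ') :
    IsGenericallyEtale (pullback.snd φ' j) := by
  obtain ⟨W, hW, hWet⟩ := h
  haveI := hWet
  refine ⟨pullback.fst φ' j ⁻¹ᵁ W, hW.preimage (pullback.fst φ' j).isOpenEmbedding.isOpenMap, ?_⟩
  have hrange : Set.range ((pullback.fst φ' j ⁻¹ᵁ W).ι ≫ pullback.fst φ' j) ⊆ Set.range W.ι := by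
    rintro _ ⟨x, rfl⟩
    rw [Scheme.Opens.range_ι]
    exact x.2
  have ht : IsOpenImmersion.lift W.ι _ hrange ≫ W.ι =
      (pullback.fst φ' j ⁻¹ᵁ W).ι ≫ pullback.fst φ' j := IsOpenImmersion.lift_fac _ _ _
  haveI : Etale (((pullback.fst φ' j ⁻¹ᵁ W).ι ≫ pullback.snd φ' j) ≫ j) := by
    rw [Category.assoc, ← pullback.condition, ← Category.assoc, ← ht, Category.assoc]
    infer_instance
  exact Etale.of_comp _ j

end BaseChange

/-! ## 4.7: passing to a projective closure -/

section Compactification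

/-- The set-theoretic identity behind de Jong 1996, 4.7 ("Note that
`j₁(φ₁⁻¹(Z)) ∪ X̄₁ ∖ X₁ = φ̄₁⁻¹(Z̄)`"), for `X₁ = φ̄₁⁻¹(j(X))` realised as any `X₁` with maps
`ι : X₁ → X̄₁'`, `φ₁ : X₁ → X` such that `ι(X₁) = φ̄₁⁻¹(j(X))` and `φ̄₁ ∘ ι = j ∘ φ₁`, and
`j`, `j̄₁` injective: `(j̄₁ ∘ ι)(φ₁⁻¹ Z) ∪ (range (j̄₁ ∘ ι))ᶜ = j̄₁(φ̄₁⁻¹(j(Z) ∪ (range j)ᶜ)) ∪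
(range j̄₁)ᶜ`. [cite: DeJong1996, 4.7, p. 67] -/
theorem DeJong1996.image_preimage_union_compl_range {α β γ δ ε : Type*} {ι : α → β} {φ₁ : α → δ}
    {φ' : β → ε} {j : δ → ε} {j' : β → γ} (hj : Function.Injective j)
    (hj' : Function.Injective j') (hrange : Set.range ι = φ' ⁻¹' Set.range j)
    (hcomm : ∀ a, φ' (ι a) = j (φ₁ a)) (Z : Set δ) :
    (j' ∘ ι) '' (φ₁ ⁻¹' Z) ∪ (Set.range (j' ∘ ι))ᶜ =
      j' '' (φ' ⁻¹' (j '' Z ∪ (Set.range j)ᶜ)) ∪ (Set.range j')ᶜ := by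
  ext y
  simp only [Set.mem_union, Set.mem_image, Set.mem_preimage, Set.mem_compl_iff, Set.mem_range,
    Function.comp_apply, not_exists]
  constructor
  · rintro (⟨a, ha, rfl⟩ | hy)
    · exact Or.inl ⟨ι a, Or.inl ⟨φ₁ a, ha, (hcomm a).symm⟩, rfl⟩
    · by_cases hy' : ∃ b, j' b = y
      · obtain ⟨b, rfl⟩ := hy'
        refine Or.inl ⟨b, Or.inr fun x hx => ?_, rfl⟩
        have hb : b ∈ Set.range ι := by rw [hrange]; exact ⟨x, hx⟩
        obtain ⟨a, rfl⟩ := hb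
        exact hy a rfl
      · exact Or.inr fun b hb => hy' ⟨b, hb⟩
  · rintro (⟨b, hb | hb, rfl⟩ | hy)
    · obtain ⟨z, hz, hzb⟩ := hb
      have hb' : b ∈ Set.range ι := by rw [hrange]; exact ⟨z, hzb⟩
      obtain ⟨a, rfl⟩ := hb'
      refine Or.inl ⟨a, ?_, rfl⟩
      rw [hcomm a] at hzb
      rwa [← hj hzb]
    · refine Or.inr fun a ha => hb (φ₁ a) ?_
      rw [← hcomm a, hj' ha]
    · exact Or.inr fun a ha => hy (ι a) ha

/-- **de Jong 1996, 4.7: reduction to a projective closure.** Let `j : X → X̄` be an open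
immersion of integral schemes over `k` and `Z̄ = j(Z) ∪ X̄ ∖ j(X)`. If
`φ̄₁ : X̄₁' → X̄`, `j̄₁ : X̄₁' → X̄₁` "solves the problem for the pair `(X̄, Z̄)`" (with the
generically-étale clause), then `X₁ = φ̄₁⁻¹(j(X))` (here `X̄₁' ×_{X̄} X`), `φ₁ = φ̄₁|_{X₁}` and
`j₁ : X₁ → X̄₁'→ X̄₁` solve it for `(X, Z)`: "Note that `j₁(φ₁⁻¹(Z)) ∪ X̄₁ ∖ X₁ = φ̄₁⁻¹(Z̄)` and
that `φ₁` is an alteration" — and `φ₁` is generically étale with `φ̄₁` (4.4).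
[cite: DeJong1996, 4.7, p. 67] -/
theorem DeJong1996.ConclusionGenericallyEtale.of_isOpenImmersion {k : Type u} [Field k]
    {X Xbar : Scheme.{u}} [IsIntegral X] [IsIntegral Xbar] {fbar : Xbar ⟶ Spec (.of k)}
    (j : X ⟶ Xbar) [IsOpenImmersion j] {Z : Set X}
    (h : DeJong1996.ConclusionGenericallyEtale fbar (j '' Z ∪ (Set.range j)ᶜ)) :
    DeJong1996.ConclusionGenericallyEtale (j ≫ fbar) Z := by
  obtain ⟨X₁', Xbar₁, φ', j', g, hφ', hj', hint, hproj, hreg, hcomm, hsnc, het⟩ := h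
  haveI := hj'
  refine ⟨pullback φ' j, Xbar₁, pullback.snd φ' j, pullback.fst φ' j ≫ j', g,
    hφ'.pullback_snd_of_isOpenImmersion φ' j, inferInstance, hint, hproj, hreg, ?_, ?_,
    het.pullback_snd_of_isOpenImmersion φ' j⟩
  · rw [Category.assoc, hcomm, ← Category.assoc, pullback.condition, Category.assoc]
  · have e : ∀ {A B C : Scheme.{u}} (a : A ⟶ B) (b : B ⟶ C), ⇑(a ≫ b) = ⇑b ∘ ⇑a :=
      fun a b => funext fun x => Scheme.Hom.comp_apply a b x
    have hset : (pullback.fst φ' j ≫ j') '' (pullback.snd φ' j ⁻¹' Z) ∪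
        (Set.range (pullback.fst φ' j ≫ j'))ᶜ =
          j' '' (φ' ⁻¹' (j '' Z ∪ (Set.range j)ᶜ)) ∪ (Set.range j')ᶜ := by
      rw [e]
      refine DeJong1996.image_preimage_union_compl_range j.isOpenEmbedding.injective
        j'.isOpenEmbedding.injective (Scheme.Pullback.range_fst φ' j) (fun a => ?_) Z
      rw [← Scheme.Hom.comp_apply, pullback.condition, Scheme.Hom.comp_apply]
    rw [hset]
    exact hsnc

/-- The boundary `j(Z) ∪ X̄ ∖ j(X)` of 4.7 is closed: its complement is `j(X ∖ Z)`, the image of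
an open set under an open immersion. [folklore] -/
theorem DeJong1996.isClosed_image_union_compl_range {X Xbar : Scheme.{u}} (j : X ⟶ Xbar)
    [IsOpenImmersion j] {Z : Set X} (hZ : IsClosed Z) : IsClosed (j '' Z ∪ (Set.range j)ᶜ) := by
  have hc : (j '' Z ∪ (Set.range j)ᶜ)ᶜ = j '' Zᶜ := by
    ext y
    simp only [Set.mem_compl_iff, Set.mem_union, Set.mem_image, Set.mem_range, not_or, not_exists,
      not_and, not_forall, not_not]
    constructor
    · rintro ⟨h1, x, rfl⟩
      exact ⟨x, fun hx => h1 x hx rfl, rfl⟩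
    · rintro ⟨x, hx, rfl⟩
      exact ⟨fun x' hx' e => hx (j.isOpenEmbedding.injective e ▸ hx'), x, rfl⟩
  rw [← isOpen_compl_iff, hc]
  exact j.isOpenEmbedding.isOpenMap _ hZ.isOpen_compl

/-- The boundary `j(Z) ∪ X̄ ∖ j(X)` of 4.7 is a proper subset as soon as `Z ⊂ X` is.
[folklore] -/
theorem DeJong1996.image_union_compl_range_ne_univ {X Xbar : Scheme.{u}} (j : X ⟶ Xbar)
    [IsOpenImmersion j] {Z : Set X} (hZ : Z ≠ Set.univ) : j '' Z ∪ (Set.range j)ᶜ ≠ Set.univ := by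
  obtain ⟨x, hx⟩ := (Set.ne_univ_iff_exists_notMem Z).mp hZ
  refine (Set.ne_univ_iff_exists_notMem _).mpr ⟨j x, ?_⟩
  rintro (⟨x', hx', e⟩ | h)
  · exact hx (j.isOpenEmbedding.injective e ▸ hx')
  · exact h ⟨x, rfl⟩

/-- **de Jong 1996, 4.6–4.7: reduction to projective varieties** (over any field `k`). "4.6. We
apply Chow's lemma to the variety `X`. This gives a modification `φ : X' → X` such that `X'` is
quasi-projective over `k`. Put `Z' = φ⁻¹(Z)`. As remarked in 4.4 […] we reduce to the case where
[…] (ii) `X` is quasi-projective. 4.7. […] Let `j : X → X̄` be an open immersion of `X` into a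
projective variety […] We have reduced the problem to the case where […] (iii) `X` is
projective." Precisely: Thm. 4.1 with its generically-étale clause for `(X, Z)` follows from the
same statement for all pairs `(X', Z')` over `k` with `X'` a projective variety
(`Literature.AlgebraicGeometry.Motives.IsProjectiveOver`) of the same dimension as `X` and
`Z' ⊂ X'` a proper closed subset. Proof: Chow's lemma in the integral form
(`ChowLemmaIntegral_holds`) gives a modification `π : X' → X` — a generically étale alteration
(`IsGenericallyEtale.of_isIso_morphismRestrict`), so 4.4 applies
(`DeJong1996.ConclusionGenericallyEtale.of_isAlteration`) and `dim X' = dim X`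
(`IsAlteration.topologicalKrullDim_eq`) — together with an immersion `ι : X' → ℙⁿ_k` over `k`;
the scheme-theoretic image `X̄'` of `ι` is a projective variety containing `X'` as an open
subscheme (Mathlib: `ι.toImage` is an open immersion for a quasi-compact immersion) of the same
dimension (`topologicalKrullDim_eq_of_isOpenImmersion`), and 4.7
(`DeJong1996.ConclusionGenericallyEtale.of_isOpenImmersion`) concludes.
[cite: DeJong1996, 4.6–4.7, pp. 66–67] -/
theorem DeJong1996.conclusionGenericallyEtale_of_projective {k : Type u} [Field k] {X : Scheme.{u}}
    (f : X ⟶ Spec (.of k)) [IsSeparated f] [LocallyOfFiniteType f] [QuasiCompact f] [IsIntegral X]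
    {Z : Set X} (hZ : IsClosed Z) (hZ' : Z ≠ Set.univ)
    (H : ∀ (X' : Scheme.{u}) (f' : X' ⟶ Spec (.of k)) (Z' : Set X'), IsIntegral X' →
      Literature.AlgebraicGeometry.Motives.IsProjectiveOver (Over.mk f') → IsClosed Z' →
        Z' ≠ Set.univ → topologicalKrullDim X' = topologicalKrullDim X →
          DeJong1996.ConclusionGenericallyEtale f' Z') :
    DeJong1996.ConclusionGenericallyEtale f Z := by
  obtain ⟨n, X', π, ι, hX', hι, hπ, hsurj, hcomm, U, hU, hU', hiso⟩ :=
    ChowLemmaIntegral_holds k X f ‹_› ‹_› ‹_› ‹_›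
  haveI := hX'
  haveI := hι
  haveI := hπ
  haveI := hsurj
  haveI := hiso
  -- `π` is a generically étale alteration (a modification)
  have hπalt : IsAlteration π := ⟨hX', hπ, inferInstance, U, hU.nonempty, inferInstance⟩
  have hπet : IsGenericallyEtale π := IsGenericallyEtale.of_isIso_morphismRestrict π U hU'
  apply DeJong1996.ConclusionGenericallyEtale.of_isAlteration hπalt hπet
  -- the projective closure of `X'` in `ℙⁿ_k`
  let P := Literature.AlgebraicGeometry.Motives.projectiveSpace n k
  haveI : IsProper P.hom := Literature.AlgebraicGeometry.Motives.isProper_projectiveSpace n k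
  haveI : QuasiCompact (ι ≫ P.hom) := by rw [hcomm]; infer_instance
  haveI : QuasiCompact ι := QuasiCompact.of_comp ι P.hom
  haveI : IsIntegral ι.image := ChowLemmaProof.isIntegral_image ι
  have hfac : π ≫ f = ι.toImage ≫ ι.imageι ≫ P.hom := by
    rw [← Category.assoc, Scheme.Hom.toImage_imageι, hcomm]
  rw [hfac]
  apply DeJong1996.ConclusionGenericallyEtale.of_isOpenImmersion ι.toImage
  apply H
  · infer_instance
  · exact ⟨n, Over.homMk ι.imageι rfl, inferInstanceAs (IsClosedImmersion ι.imageι)⟩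
  · exact DeJong1996.isClosed_image_union_compl_range ι.toImage (hZ.preimage π.continuous)
  · apply DeJong1996.image_union_compl_range_ne_univ ι.toImage
    obtain ⟨x, hx⟩ := (Set.ne_univ_iff_exists_notMem Z).mp hZ'
    obtain ⟨x', rfl⟩ := π.surjective x
    exact (Set.ne_univ_iff_exists_notMem _).mpr ⟨x', hx⟩
  · haveI : LocallyOfFiniteType (ι.imageι ≫ P.hom) := inferInstance
    rw [← topologicalKrullDim_eq_of_isOpenImmersion (ι.imageι ≫ P.hom) ι.toImage,
      hπalt.topologicalKrullDim_eq f]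

end Compactification


end Literature.AlgebraicGeometry.Resolution

end
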